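import Summits.ResolutionOfSingularities.ResolutionOfSingularities.Theorems.PurelyInseparableDim4ResConeRotationPartner
import Summits.ResolutionOfSingularities.ResolutionOfSingularities.Theorems.PurelyInseparableDim4UnitClassVertex
import Summits.ResolutionOfSingularities.ResolutionOfSingularities.Theorems.PurelyInseparableDim4ResConeLightLossyStep
import Summits.ResolutionOfSingularities.ResolutionOfSingularities.Theorems.PurelyInseparableDim4JetColength
import HarnessLib
import HarnessLib.Audit.Tags

/-!
# Purely inseparable four-folds — the LOSS-FREE TWIN of a LOSSY step: order, isolation, `e_G` and the residual cone of
# the swap partner, for ANY cone (cell `res-dim4-pi`, K2(p) lane, slice C, light-lossy class; kernel seat res-dim4-p-1 g4)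

[OURS · counted 0 · cell `res-dim4-pi` · K2(p) lane (holder res-dim4-p-12 g4, memo §17 «LIGHT LOSSY binary-cone tails at
(5,3)»; kernel seat res-dim4-p-1 g4 2026-08-29 06:09Z); over the K24a swap partner `rotation_partner_rel` (SN1,
`…ResConeRotationPartner`), `resForm_of_diag_rel` (`…ResConeSwapCone`) and res-dim4-p-7 g4's general `e_G` transfer
`SwapNorm.finrank_resVertex_eq_of_slotUnit_rel` (`…UnitClassVertex`).]  Nothing here proves K2(5), `NoIsolatedTrap 5 5`
or resolution of singularities in dimension ≥ 4 / characteristic `p`; the light-lossy class is NOT killed here.  AI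
kernel work, weaker than expert review.

WHY.  A LOSSY step (chart the free letter `f`, translate one boundary letter `a` by `τ′`, holder's `lossy_step_shape`) is
the K24a «rotation»: its child `A = step p univ f (τ′·e_a) s` and the child `B = step p univ a (τ·e_f) s` of the
LOSS-FREE step of the same parent charting `a` (`τ τ′ = 1`) satisfy `B.F = clean_p((x_f + τ)^p · θ(A.F)) + E`,
`E ∈ 𝔪^M` for every `M`, `θ` DIAGONAL along `Equiv.swap a f`.  K24a read this relation on a POWER cone
(`rotation_partner_readings`, `e_G = 3`); this file reads it for ANY cone — in particular the BINARY cone (`e_G = 2`)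
of slice C — so that whatever invariant kills the loss-free light steps can be pushed through the lossy ones.

* §1 `isUnit_det_tangent_of_diag` — the tangent matrix of a diagonal unit-class substitution is a monomial matrix,
  hence invertible.
* §2 **`lossy_partner_package`** — `ord₀ B.F = ord₀ A.F`, `B` isolated, `e_G(B) = e_G(A)`, `B.r = A.r ∘ swap`, and
  `resForm B = c · resForm A ∘ (diagonal letter map)` (`c ≠ 0`): the loss-free twin carries the same shade, isolation,
  kernel dimension and — up to a diagonal linear change of letters — the same residual cone.
* §3 **`lossy_step_twin`** — the chain dress at a LOSSY light step `k ≥ k₀` of a `(5,3)`, `e_G ≡ 2` tail (holder's L0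
  vocabulary): the twin of `c (k+1)` is a state of order `6`, isolated, with `e_G = 2`.

[cite: CossartJannsenSaito2020, Def. 2.18, Thm. 3.14] [cite: Hauser2010, §6 (coordinate changes)]
bears_on: LADDER-RESOLUTION:D157-DOOR2 (res-dim4-pi · K2(p) · slice C · (5,3) light-lossy class).  Supports
stmt-ResolutionOfSingularities-16155 (helper).
-/

set_option linter.dupNamespace false -- mandated namespace of this single-conjunct summit

noncomputable section

namespace Summit.ResolutionOfSingularities.ResolutionOfSingularities.Theorems.PIDim4

namespace ResCone

open MvPolynomial Finset
open Literature.AlgebraicGeometry.Resolution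
open Literature.AlgebraicGeometry.Resolution.CentreBlowup
open Literature.AlgebraicGeometry.Resolution.Hauser2010
open Literature.AlgebraicGeometry.Resolution.HauserPerlega2019

variable {K : Type} [Field K]

/-! ## §1 The tangent of a diagonal unit-class substitution -/

section Tangent

variable {π : Equiv.Perm (Fin 4)} {θ e : Fin 4 → MvPolynomial (Fin 4) K}

/-- The linear coefficient `coeff_{x_i}(x_m · e)` is `[i = m] · e(0)`. [folklore] -/
theorem coeff_single_X_mul' (i m : Fin 4) (g : MvPolynomial (Fin 4) K) :
    coeff (Finsupp.single i 1) (X m * g) = if i = m then constantCoeff g else 0 := by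
  classical
  rw [coeff_X_mul']
  have hmem : m ∈ (Finsupp.single i 1 : Fin 4 →₀ ℕ).support ↔ i = m := by
    rw [Finsupp.mem_support_iff, Finsupp.single_apply]; simp
  by_cases h : i = m
  · subst h
    rw [if_pos (hmem.mpr rfl), if_pos rfl, tsub_self, ← constantCoeff_eq]
  · rw [if_neg (fun h' => h (hmem.mp h')), if_neg h]

/-- **The tangent matrix of a diagonal unit class is invertible**: for `θ(x_{π i}) = x_i · e_i` with `e_i(0) ≠ 0`, the
matrix `N k i = coeff_{x_i} θ(x_k)` is the monomial matrix `(diag e(0)) ∘ π⁻¹`, so `det N = ± ∏ e_i(0) ≠ 0`. [folklore] -/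
theorem isUnit_det_tangent_of_diag (hθ : ∀ i, θ (π i) = X i * e i) (he : ∀ i, constantCoeff (e i) ≠ 0) :
    IsUnit (Matrix.det (Matrix.of fun k i => coeff (Finsupp.single i 1) (θ k))) := by
  classical
  have hN : (Matrix.of fun k i => coeff (Finsupp.single i 1) (θ k)) =
      (Matrix.diagonal fun m => constantCoeff (e m)).submatrix π.symm id := by
    ext k i
    rw [Matrix.of_apply, Matrix.submatrix_apply, id, Matrix.diagonal_apply, diag_apply hθ, coeff_single_X_mul']
    by_cases h : i = π.symm k
    · rw [if_pos h, if_pos h.symm]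
    · rw [if_neg h, if_neg (Ne.symm h)]
  rw [hN, Matrix.det_permute, Matrix.det_diagonal]
  refine IsUnit.mul ?_ (isUnit_iff_ne_zero.mpr (Finset.prod_ne_zero_iff.mpr fun m _ => he m))
  rcases Int.units_eq_one_or (Equiv.Perm.sign π.symm) with h | h <;> simp [h]

/-- The determinant of a diagonal matrix of units with permuted rows is a unit. [folklore] -/
theorem isUnit_det_diagonal_submatrix {c : Fin 4 → K} (hc : ∀ m, c m ≠ 0) (σ : Equiv.Perm (Fin 4)) :
    IsUnit ((Matrix.diagonal c).submatrix σ id).det := by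
  rw [Matrix.det_permute, Matrix.det_diagonal]
  refine IsUnit.mul ?_ (isUnit_iff_ne_zero.mpr (Finset.prod_ne_zero_iff.mpr fun m _ => hc m))
  rcases Int.units_eq_one_or (Equiv.Perm.sign σ) with h | h <;> simp [h]

end Tangent

/-! ## §2 The loss-free twin of a lossy step, for any cone -/

section Twin

variable (p : ℕ) [hp : Fact p.Prime] [CharP K p] [DecidableEq K]

/-- **THE LOSS-FREE TWIN OF A LOSSY STEP** (setting in the module docstring; `A = step p univ f (τ′·e_a) s` the lossy
child, `B = step p univ a (τ·e_f) s` the loss-free twin, `τ τ′ = 1`, `x^p`-high parent, `A` isolated with a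
certificate, `ord₀ A.F = o` prime to `p`, `x^{A.r} ∣ A.F`): `ord₀ B.F = o`, `B` is isolated, `B.r = A.r ∘ swap a f`,
`e_G(B) = e_G(A)`, and `resForm B = c · J(resForm A)` with `c ≠ 0` and `J` the diagonal letter map
`x_k ↦ e_{π⁻¹k}(0)·x_{π⁻¹k}` (`π = swap a f`; units `τ, −τ′², τ′`).  No hypothesis on the cone: this is the `e_G = 2`
(binary-cone) companion of K24a's `rotation_partner_readings`. [OURS] [cite: CossartJannsenSaito2020, Def. 2.18, Thm. 3.14] -/
theorem lossy_partner_package {s : State K} (hF : (p : ℕ∞) ≤ ordAlong Finset.univ s.F) {a f : Fin 4} (haf : a ≠ f)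
    {τ τ' : K} (hττ' : τ * τ' = 1) {o N : ℕ}
    (hiso : IsIsolated p (CentreBlowup.step p Finset.univ f (Pi.single a τ' : Fin 4 → K) s).F)
    (hN : originIdeal K ^ N ≤ singLocusIdeal p (CentreBlowup.step p Finset.univ f (Pi.single a τ' : Fin 4 → K) s).F ⊔
      originIdeal K ^ (N + 1))
    (ho : ordZero (CentreBlowup.step p Finset.univ f (Pi.single a τ' : Fin 4 → K) s).F = o) (hpo : ¬ p ∣ o)
    (hrA : ∀ d ∈ (CentreBlowup.step p Finset.univ f (Pi.single a τ' : Fin 4 → K) s).F.support,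
      (CentreBlowup.step p Finset.univ f (Pi.single a τ' : Fin 4 → K) s).r ≤ d) :
    ordZero (CentreBlowup.step p Finset.univ a (Pi.single f τ : Fin 4 → K) s).F = o ∧
    IsIsolated p (CentreBlowup.step p Finset.univ a (Pi.single f τ : Fin 4 → K) s).F ∧
    (CentreBlowup.step p Finset.univ a (Pi.single f τ : Fin 4 → K) s).r =
      (CentreBlowup.step p Finset.univ f (Pi.single a τ' : Fin 4 → K) s).r.mapDomain (Equiv.swap a f).symm ∧
    Module.finrank K (resVertex (CentreBlowup.step p Finset.univ a (Pi.single f τ : Fin 4 → K) s)) =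
      Module.finrank K (resVertex (CentreBlowup.step p Finset.univ f (Pi.single a τ' : Fin 4 → K) s)) ∧
    ∃ (c : K) (w : Fin 4 → K), c ≠ 0 ∧ (∀ i, w i ≠ 0) ∧
      (∀ i, w i = if i = a then τ else if i = f then -(τ' * τ') else τ') ∧
      resForm (CentreBlowup.step p Finset.univ a (Pi.single f τ : Fin 4 → K) s) =
        C c * aeval (fun k => C (w ((Equiv.swap a f).symm k)) * X ((Equiv.swap a f).symm k))
          (resForm (CentreBlowup.step p Finset.univ f (Pi.single a τ' : Fin 4 → K) s)) := by
  classical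
  set A := CentreBlowup.step p Finset.univ f (Pi.single a τ' : Fin 4 → K) s with hA
  set B := CentreBlowup.step p Finset.univ a (Pi.single f τ : Fin 4 → K) s with hB
  -- the relation at a level past the order and the certificate
  set M := o + N + p + 1 with hM
  obtain ⟨θ, e, E, hθ, he, heval, hE, hrel, hrB⟩ := rotation_partner_rel p hF haf hττ' (M := M) (by omega)
  have hU : constantCoeff (X f + C τ : MvPolynomial (Fin 4) K) ≠ 0 := by
    rw [map_add, constantCoeff_X, constantCoeff_C, zero_add]
    exact fun h0 => by rw [h0, zero_mul] at hττ'; exact zero_ne_one hττ'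
  -- order, isolation
  obtain ⟨hoB, -⟩ := initialForm_of_diag_rel p hθ he hU hE hrel ho hpo (by omega)
  have hisoB : IsIsolated p B.F := by
    have hθf : θ (Equiv.swap a f f) = X f * e f + 0 := by rw [hθ, add_zero]
    exact (SwapNorm.read_of_rel p (π := Equiv.swap a f) (f := f) (fun i _ => hθ i) hθf he (map_zero _)
      (coeff_zero _) hU hE hrel hiso hN (by omega) ho hpo (by omega)).1
  -- the residual cone through the diagonal letter map
  obtain ⟨c, hc, hres⟩ := resForm_of_diag_rel p hθ he hU hE hrel ho hpo (by omega) hrA hrB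
  -- `e_G` through the invertible linear substitution
  set Nm : Matrix (Fin 4) (Fin 4) K := (Matrix.diagonal fun m => constantCoeff (e m)).submatrix
    (Equiv.swap a f).symm id with hNm
  have hsubst : (fun k => C (constantCoeff (e ((Equiv.swap a f).symm k))) * X ((Equiv.swap a f).symm k)) =
      fun k => ∑ l, C (Nm k l) * (X l : MvPolynomial (Fin 4) K) := by
    funext k
    rw [Finset.sum_eq_single ((Equiv.swap a f).symm k) (fun l _ hl => by
      rw [hNm, Matrix.submatrix_apply, id, Matrix.diagonal_apply_ne _ (Ne.symm hl), C_0, zero_mul])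
      (fun h => absurd (Finset.mem_univ _) h), hNm, Matrix.submatrix_apply, id, Matrix.diagonal_apply_eq]
  have hdet : IsUnit Nm.det := isUnit_det_diagonal_submatrix he (Equiv.swap a f).symm
  have heG : Module.finrank K (resVertex B) = Module.finrank K (resVertex A) := by
    unfold resVertex
    rw [hres, SwapNorm.additiveSubspace_C_mul hc, hsubst, SwapNorm.finrank_additiveSubspace_aeval_linSubst hdet]
  exact ⟨hoB, hisoB, hrB, heG, c, fun i => constantCoeff (e i), hc, he, heval, hres⟩

/-! ## §3 The chain dress at a lossy light step -/

/-- **THE TWIN AT A LOSSY STEP OF AN `e_G ≡ 2` TAIL** (holder's L0 vocabulary): on a witnessed isolated above-floor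
`Step0 p` chain with `x^{r₀} ∣ F₀` and `e_G ≡ 2` from `k₀`, if step `k ≥ k₀` charts `f` and translates exactly the letter
`a ≠ f` (`b k = (b k a)·e_a`, `b k a ≠ 0` — the LOSSY shape of `lossy_step_shape` when `(c k).r f = 0`, `(c k).r a = 1`),
then the loss-free twin `B = step p univ a ((b k a)⁻¹·e_f) (c k)` has `ord₀ B.F = ord₀ F_{k+1}`, is isolated, has
`e_G(B) = 2`, boundary `r_{k+1} ∘ swap a f`, and residual cone `cst · J(resForm (c (k+1)))` (`J` diagonal with unit
weights `w`). [OURS] [cite: CossartJannsenSaito2020, Thm. 3.14] -/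
theorem lossy_step_twin {c : ℕ → State K} {j : ℕ → Fin 4} {b : ℕ → Fin 4 → K}
    (hc : ∀ k, IsIsolated p (c k).F ∧ Step0 p (c k) (c (k + 1))) (hw : FreeTail.IsWitnessedChain p c j b)
    (hr0 : ∀ e ∈ (c 0).F.support, (c 0).r ≤ e) (hfloor : ∀ k, ordZero (c k).F ≠ p) {k₀ : ℕ}
    (he2 : ∀ k, k₀ ≤ k → Module.finrank K (resVertex (c k)) = 2) {k : ℕ} (hk : k₀ ≤ k) {a f : Fin 4}
    (haf : a ≠ f) (hjk : j k = f) (hb : b k = Pi.single a (b k a)) (hba : b k a ≠ 0) :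
    ordZero (CentreBlowup.step p Finset.univ a (Pi.single f (b k a)⁻¹ : Fin 4 → K) (c k)).F = ordZero (c (k + 1)).F ∧
    IsIsolated p (CentreBlowup.step p Finset.univ a (Pi.single f (b k a)⁻¹ : Fin 4 → K) (c k)).F ∧
    (CentreBlowup.step p Finset.univ a (Pi.single f (b k a)⁻¹ : Fin 4 → K) (c k)).r =
      (c (k + 1)).r.mapDomain (Equiv.swap a f).symm ∧
    Module.finrank K (resVertex (CentreBlowup.step p Finset.univ a (Pi.single f (b k a)⁻¹ : Fin 4 → K) (c k))) = 2 ∧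
    ∃ (cst : K) (w : Fin 4 → K), cst ≠ 0 ∧ (∀ i, w i ≠ 0) ∧
      resForm (CentreBlowup.step p Finset.univ a (Pi.single f (b k a)⁻¹ : Fin 4 → K) (c k)) =
        C cst * aeval (fun l => C (w ((Equiv.swap a f).symm l)) * X ((Equiv.swap a f).symm l)) (resForm (c (k + 1))) := by
  have hck : c (k + 1) = CentreBlowup.step p Finset.univ f (Pi.single a (b k a)) (c k) := by
    rw [(hw k).2.2.2.2, hjk, ← hb]
  -- the band data of the chain
  obtain ⟨o₁, ho₁, hpo₁, ho₁2⟩ := chain_band p hc hfloor (k + 1)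
  have hndvd : ¬ p ∣ o₁ := by
    rintro ⟨m, rfl⟩
    rcases Nat.lt_or_ge m 2 with hm | hm
    · interval_cases m <;> omega
    · have := Nat.mul_le_mul_left p hm; omega
  obtain ⟨N, hN⟩ := RidgeBudget.exists_isCert_of_isIsolated (hc (k + 1)).1
  have hiso1 := (hc (k + 1)).1
  have hdiv1 := IsolatedBand.isolated_chain_forall_le hc hr0 (k + 1)
  have he1 := he2 (k + 1) (by omega)
  rw [hck] at hN hiso1 hdiv1 ho₁ he1
  have hF : ((p : ℕ) : ℕ∞) ≤ ordAlong Finset.univ (c k).F := (hc k).2.1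
  obtain ⟨hoB, hisoB, hrB, heG, cst, w, hcst, hw0, -, hres⟩ := lossy_partner_package p hF haf
    (τ := (b k a)⁻¹) (τ' := b k a) (inv_mul_cancel₀ hba) hiso1 hN ho₁ hndvd hdiv1
  refine ⟨?_, hisoB, by rw [hck]; exact hrB, by rw [heG, he1], cst, w, hcst, hw0, by rw [hck]; exact hres⟩
  rw [hoB, hck, ho₁]

end Twin

end ResCone

end Summit.ResolutionOfSingularities.ResolutionOfSingularities.Theorems.PIDim4

end
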